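import Literature.NumberTheory.EllipticCurves.BSDRankZeroDensityProofs
import Literature.NumberTheory.EllipticCurves.CongruentNumberCurveTorsionProofs
import Literature.NumberTheory.EllipticCurves.CongruentNumberMonskySelmerParityCorank
import Literature.NumberTheory.EllipticCurves.MordellWeilModNCard
import HarnessLib

/-!
# The `p`-primary part of `Ш` from the second descent count: `Ш[p²] = Ш[p] ⟹ Ш[p^∞] = Ш[p]`;
# for the congruent number curves, `rank 1 ∧ #Sel₂ = 2⁵ ⟹ (#Sel₄ = 2⁶ ⟺ #Ш[2^∞] = 4)` (PROVED, fact-free)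

`Proofs`-style file (theorems only: no definition, no named fact, no instance, no `sorry`;
D-0014/D-0026). Written for the discharge interface of the congruent-number residual of the leaf
`WAllCornerFTwo` (cell `bsd-print-cf2`, seat ty2): the level-two line on the crux
`RamifiedOffTYZOfFacts` (planner card `heegner-redei-level-two`) reads the Cassels–Tate
"jump-one" condition `#Sel₄(E_n) = 2⁶` on category D (`s(n) = 3`, rank `1`) as the algebraic
partner of a second-order `2`-adic law for Tian–Yuan–Zhang's `𝓛(n)`, through the support-size
statement

> `LevelTwoShaOfSelmerFour`: `rank E_n(ℚ) = 1 ∧ #Sel₂(E_n) = 2⁵ ∧ #Sel₄(E_n) = 2⁶ ⟹ #Ш(E_n)[2^∞] = 4`.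

This file proves it (and its converse given `rank 1 ∧ #Sel₂ = 2⁵`), from three tree theorems and
one line of group theory:

* the exact descent count `#Sel^(n)(E/K) = n^{rk} · #E(K)[n] · #Ш(E/K)[n]` for an elliptic curve
  over a number field (`WeierstrassCurve.natCard_selmerGroup_eq`; Silverman, *AEC*, Thm X.4.2:
  the Kummer sequence `0 → E(K)/nE(K) → Sel^(n) → Ш[n] → 0`, its three inputs
  `exists_kummerMap_holds`, `map_torsionH1ToH1_selmerGroup_holds`, `finite_selmerGroup_holds`
  all PROVED in the tree, with the Mordell–Weil theorem `module_finite_point_holds`);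
* `E_n(ℚ)_tors = E_n(ℚ)[2]` (`torsion_congruentNumberCurve_eq_torsionBy_two`; Knapp, Lemma 4.20)
  and `#E_n(ℚ)[2] = 4` (`Smith2016.natCard_torsionBy_two_congruentNumberCurve`), whence
  `#E_n(ℚ)[4] = 4`;
* group theory: in an additive group `A`, if every `p²`-torsion element is `p`-torsion then every
  `p^k`-torsion element is (`p^k x = 0 ⟹ p(p^{k-1}x) = 0 ⟹ … ⟹ p²x = 0 ⟹ px = 0`, induction), i.e.
  `A[p²] ≤ A[p] ⟹ A[p^∞] = A[p]`; no finiteness of `A` is needed.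

Hence, with `rk = 1`: `#Sel₂ = 2⁵ = 2¹·4·#Ш[2]` gives `#Ш[2] = 4`; `#Sel₄ = 2⁶ = 4¹·4·#Ш[4]` gives
`#Ш[4] = 4`; `Ш[2] ≤ Ш[4]` finite of the same order forces `Ш[4] = Ш[2]`, so `Ш[2^∞] = Ш[2]` has
order `4`. Conversely `#Ш[2^∞] = 4 = #Ш[2]` forces `Ш[2^∞] = Ш[2] ⊇ Ш[4]`, so `#Ш[4] = 4` and
`#Sel₄ = 4·4·4 = 2⁶`.

## Results

§1 (group theory, file-private helpers; `A` any additive commutative group, `p k : ℕ`):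
`torsionBy_le_torsionBy_sq` (`A[p] ≤ A[p²]`), `torsionBy_pow_le_primaryComponent`
(`A[p^k] ≤ A[p^∞]`), `torsionBy_le_primaryComponent`,
**`primaryComponent_eq_torsionBy_of_torsionBy_sq_le`** (`A[p²] ≤ A[p] ⟹ A[p^∞] = A[p]`),
`primaryComponent_eq_torsionBy_of_natCard_eq` / `natCard_primaryComponent_eq_of_natCard_eq`
(the same from `#A[p²] = #A[p]` with `A[p]` finite), and the converse bookkeeping
`torsionBy_sq_eq_torsionBy_of_natCard_primaryComponent_eq` (`#A[p^∞] = #A[p]` finite ⟹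
`A[p²] = A[p]`).

§2 (any elliptic curve `W` over a number field `K`, dot-notation on `WeierstrassCurve`):
`pow_mordellWeilRank_mul_natCard_torsionBy_mul_natCard_shaTorsionBy_eq` (the descent count in the
currency `Nat.card (Ш[n])`), `natCard_torsionBy_point_ne_zero`, `natCard_selmerGroup_eq_of_natCard_eq`
(`#E(K)[n] = t ∧ #Ш[n] = c ⟹ #Sel^(n) = n^{rk}·t·c`), `natCard_shaTorsionBy_eq_of_natCard_selmerGroup_eq`
(`#E(K)[n] = t ∧ #Sel^(n) = n^{rk}·t·c ⟹ #Ш[n] = c`), and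
**`primaryComponent_sha_eq_torsionBy_of_natCard_selmerGroup_eq`**: `#E(K)[p] = t₁`, `#E(K)[p²] = t₂`,
`#Sel^(p) = p^{rk}·t₁·c`, `#Sel^(p²) = p^{2rk}·t₂·c` ⟹ `Ш[p^∞] = Ш[p]` and `#Ш[p^∞] = c`.

§3 (the congruent number curves `E_n : y² = x³ − n²x`, `n` square-free):
`torsionBy_congruentNumberCurve_eq_torsionBy_two` (`E_n(ℚ)[m] = E_n(ℚ)[2]` for even `m ≠ 0`),
`natCard_torsionBy_four_congruentNumberCurve` (`= 4`), `natCard_shaTorsionBy_four_eq_pow`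
(`#Sel₄ = 2^{2+s} ⟹ 2rk ≤ s ∧ #Ш[4] = 2^{s−2rk}`),
**`primaryComponent_sha_two_eq_of_natCard_selmerGroup`** (`#Sel₂ = 2^{2+rk+u} ∧ #Sel₄ = 2^{2+2rk+u}
⟹ Ш[2^∞] = Ш[2] ∧ #Ш[2^∞] = 2^u`), **`natCard_primaryComponent_sha_two_eq_four_of_selmerFour`**
(= `LevelTwoShaOfSelmerFour` verbatim: rank `1`, `#Sel₂ = 2⁵`, `#Sel₄ = 2⁶ ⟹ #Ш[2^∞] = 4`) and the
equivalence **`natCard_selmerGroup_four_eq_iff_natCard_primaryComponent_sha_two_eq`** (rank `1`,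
`#Sel₂ = 2⁵ ⟹ (#Sel₄ = 2⁶ ⟺ #Ш[2^∞] = 4)`).

Bookkeeping on instances: the generic §2 lemmas carry the classical `DecidableEq` on `E(K)` of the
tree's general-`K` files, the `ℚ`-lemmas of §3 carry `ℚ`'s own; the torsion counts enter §2 through
the separate hypotheses `#E(K)[n] = t`, bridged by `convert` (the instance is a subsingleton), as in
`CongruentNumberMonskySelmerParitySelmer`.

Cell `bsd-print-cf2` (seat ty2). AI provenance: written by an AI assistant; no human has reviewed it.

## References

* [SilvermanAEC2009] J. H. Silverman, *The Arithmetic of Elliptic Curves*, 2nd ed., GTM 106,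
  Thm VIII.6.7 (Mordell–Weil), Thm X.4.2 (the `n`-descent exact sequence and finiteness).
* [Knapp1993] A. W. Knapp, *Elliptic Curves*, Princeton Math. Notes 40, Lemma 4.20 (torsion of
  `y² = x³ − n²x`).
* [HeathBrown1994SelmerCongruentII] D. R. Heath-Brown, Invent. Math. 118 (1994), §1 (the
  normalisation `#Sel₂(E_n) = 2^{2+s(n)}`).
-/

noncomputable section

open scoped Classical AddSubgroup

open WeierstrassCurve Literature.Algebra.Module

universe u

namespace Literature.NumberTheory.EllipticCurves

/-! ## §1. Group theory: `A[p²] ≤ A[p]` forces `A[p^∞] = A[p]` -/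

section GroupTheory

variable {A : Type*} [AddCommGroup A]

/-- `A[p] ≤ A[p²]` (Mathlib's `Submodule.torsionBy_le_torsionBy_of_dvd` in the `AddSubgroup.torsionBy`
currency). [folklore] -/
private theorem torsionBy_le_torsionBy_sq (p : ℕ) : A[(p : ℤ)] ≤ A[((p ^ 2 : ℕ) : ℤ)] := fun _ hx =>
  Submodule.torsionBy_le_torsionBy_of_dvd (p : ℤ) _
    (Int.natCast_dvd_natCast.mpr (Dvd.intro p (sq p).symm)) hx

/-- `A[p^k] ≤ A[p^∞]`: a `p^k`-torsion element lies in the `p`-primary component. [folklore] -/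
private theorem torsionBy_pow_le_primaryComponent (p k : ℕ) :
    A[((p ^ k : ℕ) : ℤ)] ≤ AddCommGroup.primaryComponent A p := fun _ hx =>
  (AddCommGroup.mem_primaryComponent).mpr ⟨k, AddSubgroup.torsionBy.nsmul_iff.mp hx⟩

/-- `A[p] ≤ A[p^∞]`. [folklore] -/
private theorem torsionBy_le_primaryComponent (p : ℕ) :
    A[(p : ℤ)] ≤ AddCommGroup.primaryComponent A p := fun _ hx =>
  (AddCommGroup.mem_primaryComponent).mpr
    ⟨1, by rw [pow_one]; exact AddSubgroup.torsionBy.nsmul_iff.mp hx⟩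

/-- **`A[p²] ≤ A[p] ⟹ A[p^∞] = A[p]`**: if every `p²`-torsion element is killed by `p`, then so is
every `p^k`-torsion element (`p^{k+1}x = 0 ⟹ p·(p^k x) = … ⟹` by induction `p(px) = 0`, i.e.
`x ∈ A[p²] ≤ A[p]`), so the `p`-primary component is the `p`-torsion. No finiteness is assumed.
[folklore] -/
private theorem primaryComponent_eq_torsionBy_of_torsionBy_sq_le (p : ℕ)
    (h : A[((p ^ 2 : ℕ) : ℤ)] ≤ A[(p : ℤ)]) :
    AddCommGroup.primaryComponent A p = A[(p : ℤ)] := by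
  refine le_antisymm ?_ (torsionBy_le_primaryComponent p)
  -- every `p^k`-torsion element is `p`-torsion
  have key : ∀ k : ℕ, ∀ x : A, p ^ k • x = 0 → p • x = 0 := by
    intro k
    induction k with
    | zero =>
      intro x hx
      rw [pow_zero, one_smul] at hx
      rw [hx, smul_zero]
    | succ k ih =>
      intro x hx
      have h1 : p • (p • x) = 0 := ih (p • x) (by rwa [smul_smul, ← pow_succ])
      have h2 : x ∈ A[((p ^ 2 : ℕ) : ℤ)] :=
        AddSubgroup.torsionBy.nsmul_iff.mpr (by rwa [sq, ← smul_smul])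
      exact AddSubgroup.torsionBy.nsmul_iff.mp (h h2)
  intro x hx
  obtain ⟨k, hk⟩ := (AddCommGroup.mem_primaryComponent).mp hx
  exact AddSubgroup.torsionBy.nsmul_iff.mpr (key k x hk)

/-- **`#A[p²] = #A[p]` (with `A[p]` finite) ⟹ `A[p^∞] = A[p]`**: `A[p] ≤ A[p²]` are then finite of
the same order, hence equal, and `primaryComponent_eq_torsionBy_of_torsionBy_sq_le` applies.
[folklore] -/
private theorem primaryComponent_eq_torsionBy_of_natCard_eq (p : ℕ) [Finite A[(p : ℤ)]]
    (h : Nat.card A[((p ^ 2 : ℕ) : ℤ)] = Nat.card A[(p : ℤ)]) :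
    AddCommGroup.primaryComponent A p = A[(p : ℤ)] := by
  have hle : A[(p : ℤ)] ≤ A[((p ^ 2 : ℕ) : ℤ)] := torsionBy_le_torsionBy_sq p
  haveI : Finite A[((p ^ 2 : ℕ) : ℤ)] :=
    Nat.finite_of_card_ne_zero (by rw [h]; exact Nat.card_pos.ne')
  have heq : A[(p : ℤ)] = A[((p ^ 2 : ℕ) : ℤ)] := AddSubgroup.eq_of_le_of_card_ge hle h.le
  exact primaryComponent_eq_torsionBy_of_torsionBy_sq_le p heq.symm.le

/-- `#A[p²] = #A[p]` (finite) ⟹ `#A[p^∞] = #A[p]`. [folklore] -/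
private theorem natCard_primaryComponent_eq_of_natCard_eq (p : ℕ) [Finite A[(p : ℤ)]]
    (h : Nat.card A[((p ^ 2 : ℕ) : ℤ)] = Nat.card A[(p : ℤ)]) :
    Nat.card (AddCommGroup.primaryComponent A p) = Nat.card A[(p : ℤ)] := by
  rw [primaryComponent_eq_torsionBy_of_natCard_eq p h]

/-- Converse bookkeeping: if `A[p^∞]` is finite of the same order as `A[p]`, then `A[p^∞] = A[p]`
and in particular `A[p²] = A[p]`. [folklore] -/
private theorem torsionBy_sq_eq_torsionBy_of_natCard_primaryComponent_eq (p : ℕ)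
    [Finite (AddCommGroup.primaryComponent A p)]
    (h : Nat.card (AddCommGroup.primaryComponent A p) = Nat.card A[(p : ℤ)]) :
    AddCommGroup.primaryComponent A p = A[(p : ℤ)] ∧ A[((p ^ 2 : ℕ) : ℤ)] = A[(p : ℤ)] := by
  have heq : A[(p : ℤ)] = AddCommGroup.primaryComponent A p :=
    AddSubgroup.eq_of_le_of_card_ge (torsionBy_le_primaryComponent p) h.le
  refine ⟨heq.symm, le_antisymm ?_ (torsionBy_le_torsionBy_sq p)⟩
  rw [heq]
  exact torsionBy_pow_le_primaryComponent p 2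

end GroupTheory

end Literature.NumberTheory.EllipticCurves

/-! ## §2. Elliptic curves over number fields: `#Ш[n]` from `#Sel^(n)`, and `Ш[p^∞]` from `#Sel^(p²)` -/

namespace WeierstrassCurve

open Literature.NumberTheory.EllipticCurves

variable {K : Type u} [Field K] [NumberField K] (W : WeierstrassCurve K) [W.IsElliptic]

/-- **The exact descent count in the currency `#Ш(E/K)[n]`**:
`n^{rk E(K)} · #E(K)[n] · #Ш(E/K)[n] = #Sel^(n)(E/K)` for `n ≥ 1` — the tree's
`natCard_selmerGroup_eq` (stated with the subgroup `Ш ⊓ H¹(K, E)[n]` of `H¹(K, E)`), rewritten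
with `natCard_torsionBy_addSubgroup`. [cite: SilvermanAEC2009, Thm X.4.2] -/
theorem pow_mordellWeilRank_mul_natCard_torsionBy_mul_natCard_shaTorsionBy_eq {n : ℕ}
    (hn : n ≠ 0) :
    n ^ W.mordellWeilRank * Nat.card (W.toAffine.Point[(n : ℤ)]) * Nat.card ((W.sha)[(n : ℤ)]) =
      Nat.card (W.selmerGroup n) := by
  rw [natCard_torsionBy_addSubgroup, W.natCard_selmerGroup_eq hn]

/-- `#E(K)[n] ≠ 0` for `n ≥ 1`: `E(K)[n]` is finite (Mordell–Weil, `module_finite_point_holds`)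
and contains `O`. [cite: SilvermanAEC2009, Thm VIII.6.7] -/
theorem natCard_torsionBy_point_ne_zero {n : ℕ} (hn : n ≠ 0) :
    Nat.card (W.toAffine.Point[(n : ℤ)]) ≠ 0 := by
  haveI : Module.Finite ℤ W.toAffine.Point := W.module_finite_point_holds
  haveI : NeZero n := ⟨hn⟩
  haveI : Finite (W.toAffine.Point[(n : ℤ)]) := finite_torsionBy_of_moduleFinite _ n
  exact Nat.card_pos.ne'

/-- The descent count with the two cardinalities fed in: `#E(K)[n] = t`, `#Ш[n] = c` ⟹
`#Sel^(n) = n^{rk} · t · c`. [cite: SilvermanAEC2009, Thm X.4.2] -/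
theorem natCard_selmerGroup_eq_of_natCard_eq {n : ℕ} (hn : n ≠ 0) {t c : ℕ}
    (ht : Nat.card (W.toAffine.Point[(n : ℤ)]) = t) (hc : Nat.card ((W.sha)[(n : ℤ)]) = c) :
    Nat.card (W.selmerGroup n) = n ^ W.mordellWeilRank * t * c := by
  rw [← W.pow_mordellWeilRank_mul_natCard_torsionBy_mul_natCard_shaTorsionBy_eq hn, ht, hc]

/-- **`#Ш(E/K)[n]` from the `n`-descent count**: `#E(K)[n] = t` and `#Sel^(n) = n^{rk} · t · c` ⟹
`#Ш[n] = c` (cancellation of the non-zero factor `n^{rk} · t`). [cite: SilvermanAEC2009, Thm X.4.2] -/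
theorem natCard_shaTorsionBy_eq_of_natCard_selmerGroup_eq {n : ℕ} (hn : n ≠ 0) {t c : ℕ}
    (ht : Nat.card (W.toAffine.Point[(n : ℤ)]) = t)
    (h : Nat.card (W.selmerGroup n) = n ^ W.mordellWeilRank * t * c) :
    Nat.card ((W.sha)[(n : ℤ)]) = c := by
  have h' := W.pow_mordellWeilRank_mul_natCard_torsionBy_mul_natCard_shaTorsionBy_eq hn
  have ht0 : t ≠ 0 := by
    rw [← ht]
    exact W.natCard_torsionBy_point_ne_zero hn
  rw [h, ht] at h'
  exact Nat.eq_of_mul_eq_mul_left (Nat.pos_of_ne_zero (mul_ne_zero (pow_ne_zero _ hn) ht0)) h'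

/-- **`Ш[p^∞] = Ш[p]` when the `p²`-descent count is minimal.** For an elliptic curve over a number
field with `#E(K)[p] = t₁`, `#E(K)[p²] = t₂` and, for one and the same `c`,
`#Sel^(p) = p^{rk} · t₁ · c` and `#Sel^(p²) = p^{2rk} · t₂ · c` (i.e. `#Ш[p²] = #Ш[p] = c`): the
`p`-primary part of `Ш(E/K)` IS `Ш[p]`, finite of order `c` — `Ш[p] ≤ Ш[p²]` finite of the same
order are equal, and `Ш[p²] = Ш[p] ⟹ Ш[p^∞] = Ш[p]` (`primaryComponent_eq_torsionBy_of_torsionBy_sq_le`).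
Finiteness of `Ш[p]` is Silverman X.4.2(b) (`finite_sha_torsionBy_holds`); no finiteness of `Ш` is
assumed. [cite: SilvermanAEC2009, Thm X.4.2] -/
theorem primaryComponent_sha_eq_torsionBy_of_natCard_selmerGroup_eq {p : ℕ} (hp : p ≠ 0)
    {t₁ t₂ c : ℕ} (ht₁ : Nat.card (W.toAffine.Point[(p : ℤ)]) = t₁)
    (ht₂ : Nat.card (W.toAffine.Point[((p ^ 2 : ℕ) : ℤ)]) = t₂)
    (h₁ : Nat.card (W.selmerGroup p) = p ^ W.mordellWeilRank * t₁ * c)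
    (h₂ : Nat.card (W.selmerGroup (p ^ 2 : ℕ)) = (p ^ 2) ^ W.mordellWeilRank * t₂ * c) :
    AddCommGroup.primaryComponent W.sha p = (W.sha)[(p : ℤ)] ∧
      Nat.card (AddCommGroup.primaryComponent W.sha p) = c := by
  have hc₁ := W.natCard_shaTorsionBy_eq_of_natCard_selmerGroup_eq hp ht₁ h₁
  have hc₂ := W.natCard_shaTorsionBy_eq_of_natCard_selmerGroup_eq (pow_ne_zero 2 hp) ht₂ h₂
  haveI : Finite ((W.sha)[(p : ℤ)]) :=
    W.finite_sha_torsionBy_holds (p : ℤ) (Int.natCast_ne_zero.mpr hp)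
  have heq := primaryComponent_eq_torsionBy_of_natCard_eq (A := W.sha) p (hc₂.trans hc₁.symm)
  exact ⟨heq, by rw [heq, hc₁]⟩

end WeierstrassCurve

/-! ## §3. The congruent number curves: `#E_n(ℚ)[4] = 4` and `Ш(E_n)[2^∞]` from `#Sel₄` -/

namespace Literature.NumberTheory.EllipticCurves

/-- **`E_n(ℚ)[m] = E_n(ℚ)[2]` for every even `m ≠ 0`** (`n` square-free): `E_n(ℚ)[m]` consists of
torsion points, and `E_n(ℚ)_tors = E_n(ℚ)[2]` (`torsion_congruentNumberCurve_eq_torsionBy_two`);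
conversely `2 ∣ m`. [cite: Knapp1993, Lemma 4.20] -/
theorem torsionBy_congruentNumberCurve_eq_torsionBy_two {n : ℕ} (hsq : Squarefree n) {m : ℕ}
    (hm : 2 ∣ m) (hm0 : m ≠ 0) :
    (congruentNumberCurve n).toAffine.Point[(m : ℤ)] =
      (congruentNumberCurve n).toAffine.Point[(2 : ℤ)] := by
  refine le_antisymm ?_ ?_
  · intro T hT
    rw [← torsion_congruentNumberCurve_eq_torsionBy_two hsq, AddCommGroup.mem_torsion]
    exact isOfFinAddOrder_iff_nsmul_eq_zero.mpr
      ⟨m, Nat.pos_of_ne_zero hm0, AddSubgroup.torsionBy.nsmul_iff.mp hT⟩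
  · intro T hT
    have h := Submodule.torsionBy_le_torsionBy_of_dvd (M := (congruentNumberCurve n).toAffine.Point)
      (2 : ℤ) (m : ℤ) (by exact_mod_cast hm)
    exact h hT

/-- **`#E_n(ℚ)[4] = 4`** for square-free `n`: `E_n(ℚ)[4] = E_n(ℚ)[2]` has four elements
(`Smith2016.natCard_torsionBy_two_congruentNumberCurve`). [cite: Knapp1993, Lemma 4.20] -/
theorem natCard_torsionBy_four_congruentNumberCurve {n : ℕ} (hsq : Squarefree n) :
    Nat.card ((congruentNumberCurve n).toAffine.Point[(4 : ℤ)]) = 4 := by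
  have h := torsionBy_congruentNumberCurve_eq_torsionBy_two hsq (m := 4) ⟨2, rfl⟩ four_ne_zero
  rw [Nat.cast_ofNat] at h
  rw [h]
  exact Smith2016.natCard_torsionBy_two_congruentNumberCurve hsq.ne_zero

/-- **`#Ш(E_n)[4] = 2^{s − 2rk}` from `#Sel₄(E_n) = 2^{2+s}`** (and `2·rk ≤ s`), the level-`4`
companion of `MonskySelmerParity.natCard_shaTorsionBy_two_eq_pow`: the `4`-descent count reads
`4^{rk} · 4 · #Ш[4] = 2^{2+s}`. [cite: SilvermanAEC2009, Thm X.4.2] -/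
theorem natCard_shaTorsionBy_four_eq_pow {n : ℕ} (hsq : Squarefree n) {s : ℕ}
    (hs : Nat.card ((congruentNumberCurve n).selmerGroup 4) = 2 ^ (2 + s)) :
    haveI := isElliptic_congruentNumberCurve hsq.ne_zero
    2 * (congruentNumberCurve n).mordellWeilRank ≤ s ∧
      Nat.card (AddSubgroup.torsionBy (congruentNumberCurve n).sha (4 : ℤ)) =
        2 ^ (s - 2 * (congruentNumberCurve n).mordellWeilRank) := by
  haveI := isElliptic_congruentNumberCurve hsq.ne_zero
  have h := (congruentNumberCurve n).pow_mordellWeilRank_mul_natCard_torsionBy_mul_natCard_shaTorsionBy_eq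
    (n := 4) four_ne_zero
  have hs' : Nat.card ((congruentNumberCurve n).selmerGroup ((4 : ℕ) : ℤ)) = 2 ^ (2 + s) := by
    simpa only [Nat.cast_ofNat] using hs
  -- `4^rk · 4 · S = 2^(2+s)` with `4^rk = 2^(2 rk)`
  have key : ∀ {R T S : ℕ}, 4 ^ R * T * S = 2 ^ (2 + s) → T = 4 →
      2 * R ≤ s ∧ S = 2 ^ (s - 2 * R) := by
    intro R T S hC hT
    subst hT
    have h4 : (4 : ℕ) ^ R = 2 ^ (2 * R) := by rw [pow_mul]; norm_num
    rw [h4, pow_add, show (2 : ℕ) ^ 2 = 4 by norm_num] at hC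
    have hC' : 2 ^ (2 * R) * S = 2 ^ s := by
      have : 4 * (2 ^ (2 * R) * S) = 4 * 2 ^ s := by rw [← hC]; ring
      exact Nat.eq_of_mul_eq_mul_left (by norm_num) this
    have hle : 2 * R ≤ s :=
      (Nat.pow_dvd_pow_iff_le_right (by norm_num)).mp (Dvd.intro _ hC')
    refine ⟨hle, ?_⟩
    have hpow : (2 : ℕ) ^ s = 2 ^ (2 * R) * 2 ^ (s - 2 * R) := by
      rw [← pow_add, Nat.add_sub_cancel' hle]
    rw [hpow] at hC'
    exact Nat.eq_of_mul_eq_mul_left (pow_pos (by norm_num) _) hC'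
  have h' := key (h.trans hs') (by convert natCard_torsionBy_four_congruentNumberCurve hsq; norm_num)
  simpa only [Nat.cast_ofNat] using h'

/-- **`Ш(E_n)[2^∞] = Ш(E_n)[2]`, of order `2^u`, when `#Sel₂(E_n) = 2^{2+rk+u}` and
`#Sel₄(E_n) = 2^{2+2rk+u}`** (`n` square-free; `rk` the Mordell–Weil rank): both descent counts
then give `#Ш[2] = #Ш[4] = 2^u` (`#E_n(ℚ)[2] = #E_n(ℚ)[4] = 4`), and §1–§2 apply. This is the
algebraic content of the Cassels–Tate "jump" bookkeeping at level two: the `4`-Selmer group is as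
small as the `2`-Selmer group allows iff `Ш[4] = Ш[2]`, and then the whole `2`-primary part of `Ш`
is `Ш[2]`. [cite: SilvermanAEC2009, Thm X.4.2] [cite: HeathBrown1994SelmerCongruentII, §1] -/
theorem primaryComponent_sha_two_eq_of_natCard_selmerGroup {n : ℕ} (hsq : Squarefree n) {u : ℕ}
    (h₂ : Nat.card ((congruentNumberCurve n).selmerGroup 2) =
      2 ^ (2 + (congruentNumberCurve n).mordellWeilRank + u))
    (h₄ : Nat.card ((congruentNumberCurve n).selmerGroup 4) =
      2 ^ (2 + 2 * (congruentNumberCurve n).mordellWeilRank + u)) :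
    AddCommGroup.primaryComponent (congruentNumberCurve n).sha 2 =
        AddSubgroup.torsionBy (congruentNumberCurve n).sha (2 : ℤ) ∧
      Nat.card (AddCommGroup.primaryComponent (congruentNumberCurve n).sha 2) = 2 ^ u := by
  haveI := isElliptic_congruentNumberCurve hsq.ne_zero
  have h₂' : Nat.card ((congruentNumberCurve n).selmerGroup ((2 : ℕ) : ℤ)) =
      2 ^ (congruentNumberCurve n).mordellWeilRank * 4 * 2 ^ u := by
    rw [Nat.cast_ofNat, h₂, pow_add, pow_add]
    ring
  have h₄' : Nat.card ((congruentNumberCurve n).selmerGroup ((2 ^ 2 : ℕ) : ℤ)) =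
      (2 ^ 2) ^ (congruentNumberCurve n).mordellWeilRank * 4 * 2 ^ u := by
    rw [show ((2 ^ 2 : ℕ) : ℤ) = 4 by norm_num, h₄, pow_add, pow_add, ← pow_mul]
    ring
  have h := (congruentNumberCurve n).primaryComponent_sha_eq_torsionBy_of_natCard_selmerGroup_eq
    two_ne_zero (t₁ := 4) (t₂ := 4) (c := 2 ^ u)
    (by convert Smith2016.natCard_torsionBy_two_congruentNumberCurve hsq.ne_zero; norm_num)
    (by convert natCard_torsionBy_four_congruentNumberCurve hsq; norm_num) h₂' h₄'
  simpa only [Nat.cast_ofNat] using h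

/-- **`LevelTwoShaOfSelmerFour`** (the support-size partner of the level-two line on the
congruent-number residual, verbatim): for square-free `n` with `rank E_n(ℚ) = 1`,
`#Sel₂(E_n) = 2⁵` and `#Sel₄(E_n) = 2⁶`, the `2`-primary part of `Ш(E_n/ℚ)` has exactly `4`
elements (`= Ш[2] ≅ (ℤ/2)²`; no finiteness input). [cite: SilvermanAEC2009, Thm X.4.2]
[cite: HeathBrown1994SelmerCongruentII, §1] -/
theorem natCard_primaryComponent_sha_two_eq_four_of_selmerFour (n : ℕ)
    [(congruentNumberCurve n).IsElliptic] (hsq : Squarefree n)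
    (hr : (congruentNumberCurve n).mordellWeilRank = 1)
    (h₂ : Nat.card ((congruentNumberCurve n).selmerGroup 2) = 2 ^ 5)
    (h₄ : Nat.card ((congruentNumberCurve n).selmerGroup 4) = 2 ^ 6) :
    Nat.card (AddCommGroup.primaryComponent (congruentNumberCurve n).sha 2) = 4 :=
  (primaryComponent_sha_two_eq_of_natCard_selmerGroup hsq (u := 2) (by rw [h₂, hr])
    (by rw [h₄, hr])).2

/-- Under the same hypotheses, `Ш(E_n)[2^∞] = Ш(E_n)[2]` as subgroups of `Ш(E_n/ℚ)`.
[cite: SilvermanAEC2009, Thm X.4.2] -/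
theorem primaryComponent_sha_two_eq_torsionBy_of_selmerFour (n : ℕ)
    [(congruentNumberCurve n).IsElliptic] (hsq : Squarefree n)
    (hr : (congruentNumberCurve n).mordellWeilRank = 1)
    (h₂ : Nat.card ((congruentNumberCurve n).selmerGroup 2) = 2 ^ 5)
    (h₄ : Nat.card ((congruentNumberCurve n).selmerGroup 4) = 2 ^ 6) :
    AddCommGroup.primaryComponent (congruentNumberCurve n).sha 2 =
      AddSubgroup.torsionBy (congruentNumberCurve n).sha (2 : ℤ) :=
  (primaryComponent_sha_two_eq_of_natCard_selmerGroup hsq (u := 2) (by rw [h₂, hr])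
    (by rw [h₄, hr])).1

/-- **The jump-one condition IS the `Ш`-side of BSD₂ on category D with rank `1`**: for square-free
`n` with `rank E_n(ℚ) = 1` and `#Sel₂(E_n) = 2⁵` (so `#Ш[2] = 4`),
`#Sel₄(E_n) = 2⁶ ⟺ #Ш(E_n)[2^∞] = 4`. (⟸: `Ш[2] ≤ Ш[2^∞]` finite of the same order `4` are
equal, so `Ш[4] = Ш[2]` has order `4` and `#Sel₄ = 4¹ · 4 · 4`.) [cite: SilvermanAEC2009, Thm X.4.2]
[cite: HeathBrown1994SelmerCongruentII, §1] -/
theorem natCard_selmerGroup_four_eq_iff_natCard_primaryComponent_sha_two_eq (n : ℕ)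
    [(congruentNumberCurve n).IsElliptic] (hsq : Squarefree n)
    (hr : (congruentNumberCurve n).mordellWeilRank = 1)
    (h₂ : Nat.card ((congruentNumberCurve n).selmerGroup 2) = 2 ^ 5) :
    Nat.card ((congruentNumberCurve n).selmerGroup 4) = 2 ^ 6 ↔
      Nat.card (AddCommGroup.primaryComponent (congruentNumberCurve n).sha 2) = 4 := by
  refine ⟨natCard_primaryComponent_sha_two_eq_four_of_selmerFour n hsq hr h₂, fun h => ?_⟩
  -- `#Ш[2] = 4` from the `2`-descent count
  have hsha₂ : Nat.card (AddSubgroup.torsionBy (congruentNumberCurve n).sha (2 : ℤ)) = 4 := by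
    have h' := (MonskySelmerParity.natCard_shaTorsionBy_two_eq_pow hsq.ne_zero (s := 3) h₂).2
    rw [hr] at h'
    simpa using h'
  -- `Ш[2^∞]` is finite of order `4 = #Ш[2]`, so `Ш[4] = Ш[2]`
  haveI : Finite (AddCommGroup.primaryComponent (congruentNumberCurve n).sha 2) :=
    Nat.finite_of_card_ne_zero (by rw [h]; norm_num)
  have h42 := (torsionBy_sq_eq_torsionBy_of_natCard_primaryComponent_eq
    (A := (congruentNumberCurve n).sha) 2 (h.trans hsha₂.symm)).2
  have hsha₄ : Nat.card (AddSubgroup.torsionBy (congruentNumberCurve n).sha ((4 : ℕ) : ℤ)) = 4 := by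
    rw [show ((4 : ℕ) : ℤ) = ((2 ^ 2 : ℕ) : ℤ) by norm_num, h42, Nat.cast_ofNat, hsha₂]
  have hsel := (congruentNumberCurve n).natCard_selmerGroup_eq_of_natCard_eq four_ne_zero
    (t := 4) (c := 4) (by convert natCard_torsionBy_four_congruentNumberCurve hsq; norm_num) hsha₄
  rw [hr] at hsel
  simp only [Nat.cast_ofNat] at hsel
  rw [hsel]
  norm_num

end Literature.NumberTheory.EllipticCurves

end
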